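import Summits.CriticalPhenomena.CardyFormulaZ2.Theorems.CardyMagicRigidityNestingRigidityNeckZ2NodeBK
import Literature.Probability.Percolation.ReimerLocalFinitary
import HarnessLib

/-!
# Crux `NestingRigidity`, line `pinch-resampling` (v4), stub S12: four-arm node events AND arms of further distinct clusters (Reimer glue)

Crux `Summit.CriticalPhenomena.CardyFormulaZ2.Theses.CardyMagicRigidity.NestingRigidity`
(stmt-CriticalPhenomena-4835), line `pinch-resampling` v4, stub S12 `stub_neckHookupCoarseZ2 : NeckHookupCoarseZ2`.
The glue between the two probabilistic primitives of the summation of the `𝔄`-error over the necklace of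
`…NeckZ2CoveringAChain`: the product of four-arm node events over pairwise disjoint annuli
(`real_biInter_fourArmTwoClustersAt_le_prod_rpow`, `…NeckZ2NodeProduct`) and the van den Berg–Kesten bound for the
arms of pairwise distinct clusters (`real_distinctClusters_arms_le_prod`, `…NeckZ2NodeBK`), by the tree's Reimer
inequality for a local event against finitary increasing events (`reimer_local_finitary_list`,
`mem_inter_disjointOccurrenceList_of_witnesses`, `ReimerLocalFinitary.lean`):

**`real_fourArm_and_distinctArms_le` (registered anchor).**  If pairwise disjoint annuli `zAnn (w a) (r a) (R a)`
carry two open crossings not joined inside the annulus, and points `c i` (`|c i - w' i|_∞ < r' i`) are joined by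
open paths to sup distance `≥ R' i` from `w' i`, the `c i` lying in pairwise distinct open clusters which moreover
do not contain the starting points of the crossings, then the probability is at most
`(∏ c (r a / R a)^{1+ε}) · ∏ C (r' i / (R' i - 1))^α` — the arm annuli may overlap each other and the four-arm
annuli arbitrarily.  Witnesses: the open edges of the crossings and the CLOSED pairs of the annuli (a cylinder
inside the four-arm events, §1), against the open edges of the arms (edge-disjoint: distinct clusters).
-/

noncomputable section

namespace Summit.CriticalPhenomena.CardyFormulaZ2.Cruxes.NestingRigidity.PinchResampling

open MeasureTheory Set Literature.Probability.Percolation Literature.Probability.LatticeModels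
open ZPinchLocality

namespace NeckCoarseZ2

variable {ω : BondConfig (Site 2)}

/-! ## §1 A cylinder inside the four-arm event -/

/-- A path inside `A` that is open in `ω'` is open in `ω`, if every pair of `A` open in `ω'` is open in `ω`. -/
theorem pathIn_of_pairs_subset {ω' : BondConfig (Site 2)} {A : Set (Site 2)}
    (h : ∀ a ∈ A, ∀ b ∈ A, s(a, b) ∈ ω' → s(a, b) ∈ ω) {u v : Site 2} (hp : PathIn (openGraph ω') A u v) :
    PathIn (openGraph ω) A u v := by
  obtain ⟨hu, p⟩ := hp
  induction p with
  | refl => exact PathIn.refl hu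
  | @tail b c hub hbc ih =>
    have hb : b ∈ A := PathIn.right_mem (show PathIn (openGraph ω') A u b from ⟨hu, hub⟩)
    have hadj := (openGraph_adj ω' b c).1 hbc.1
    exact ih.tail ((openGraph_adj ω b c).2 ⟨h b hb c hbc.2 hadj.1, hadj.2⟩) hbc.2

/-- **A cylinder inside the four-arm event**: if `ω` carries two open crossings of `zAnn w r R` with finite open
witnesses `W₁, W₂ ⊆ ω` and the crossings' starts are not joined inside the annulus, then every configuration
agreeing with `ω` on `W₁ ∪ W₂` and on the closed pairs of the annulus is in `fourArmTwoClustersAt w r R`. -/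
theorem localCylinder_subset_fourArm {w : Site 2} {r R : ℕ} (hr : 1 ≤ r) (hrR : r ≤ R) {p₁ q₁ p₂ q₂ : Site 2}
    (hp₁ : zNorm (p₁ - w) = r) (hq₁ : zNorm (q₁ - w) = R) (hp₂ : zNorm (p₂ - w) = r) (hq₂ : zNorm (q₂ - w) = R)
    {W₁ W₂ : Finset (Sym2 (Site 2))} (hW₁ : ↑W₁ ⊆ ω) (hW₂ : ↑W₂ ⊆ ω)
    (h₁ : PathIn (openGraph ↑W₁) (zAnn w r R) p₁ q₁) (h₂ : PathIn (openGraph ↑W₂) (zAnn w r R) p₂ q₂)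
    (hn : ¬ PathIn (openGraph ω) (zAnn w r R) p₁ p₂) :
    localCylinder (↑W₁ ∪ ↑W₂ ∪ ((zAnn w r R).sym2 \ ω)) ω ⊆ fourArmTwoClustersAt w r R := by
  intro ω' hω'
  have hW₁' : (↑W₁ : Set (Sym2 (Site 2))) ⊆ ω' := fun e he ↦ (hω' e (Or.inl (Or.inl he))).2 (hW₁ he)
  have hW₂' : (↑W₂ : Set (Sym2 (Site 2))) ⊆ ω' := fun e he ↦ (hω' e (Or.inl (Or.inr he))).2 (hW₂ he)
  refine mem_fourArmTwoClustersAt_of_crossings hr hrR hp₁ hq₁ hp₂ hq₂ (h₁.mono_graph (openGraph_mono hW₁'))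
    (h₂.mono_graph (openGraph_mono hW₂')) fun h ↦ hn (pathIn_of_pairs_subset (fun a ha b hb hab ↦ ?_) h)
  by_contra hω
  exact ((hω' _ (Or.inr ⟨Set.mk_mem_sym2_iff.2 ⟨ha, hb⟩, hω⟩)).1 hab |> hω)

/-- The sure event is local. -/
theorem isLocalEvent_univ' : IsLocalEvent (univ : Set (BondConfig (Site 2))) :=
  ⟨∅, (determinedBy_iff _ _).2 fun _ _ _ ↦ by simp⟩

/-- A finite intersection of four-arm events is local. -/
theorem isLocalEvent_biInter_fourArm {ι : Type*} (t : Finset ι) (w : ι → Site 2) (r R : ι → ℕ)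
    (hr : ∀ a ∈ t, 1 ≤ r a) : IsLocalEvent (⋂ a ∈ t, fourArmTwoClustersAt (w a) (r a) (R a)) := by
  classical
  induction t using Finset.induction_on with
  | empty => simpa using isLocalEvent_univ'
  | @insert a t hat ih =>
    rw [Finset.set_biInter_insert]
    refine IsLocalEvent.inter_isLocalEvent ?_ (ih fun b hb ↦ hr b (Finset.mem_insert_of_mem hb))
    have h := determinedBy_fourArmTwoClustersAt (w a) (hr a (Finset.mem_insert_self a t)) (R a)
    rw [← (finite_sym2 (zAnn_finite (w a) (r a) (R a))).coe_toFinset] at h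
    exact ⟨_, h⟩

/-! ## §2 The deterministic core: disjoint occurrence -/

/-- **Disjoint occurrence of the four-arm events and the arm events** (deterministic core of
`real_fourArm_and_distinctArms_le`): on a lattice configuration, crossings of the annuli as in the four-arm events
and arms of pairwise distinct clusters avoiding the crossings' starts give
`ω ∈ (⋂ four-arm events) □ (arm event □ arm event □ ⋯)`. -/
theorem mem_fourArm_disjointOccurrence_arms (hHG : ∀ a b, (openGraph ω).Adj a b → (zdGraph 2).Adj a b)
    {ι κ : Type*} (t : Finset ι) (w : ι → Site 2) (r R : ι → ℕ) (hrR : ∀ a ∈ t, 1 ≤ r a ∧ r a ≤ R a)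
    (l : List κ) (hl : l.Nodup) (w' : κ → Site 2) (r' R' : κ → ℕ) (hrR' : ∀ i ∈ l, r' i ≤ R' i)
    (p₁ q₁ p₂ q₂ : ι → Site 2) (c : κ → Site 2)
    (h4a : ∀ a ∈ t, zNorm (p₁ a - w a) = r a ∧ zNorm (q₁ a - w a) = R a ∧ zNorm (p₂ a - w a) = r a ∧
      zNorm (q₂ a - w a) = R a ∧ PathIn (openGraph ω) (zAnn (w a) (r a) (R a)) (p₁ a) (q₁ a) ∧
      PathIn (openGraph ω) (zAnn (w a) (r a) (R a)) (p₂ a) (q₂ a) ∧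
      ¬ PathIn (openGraph ω) (zAnn (w a) (r a) (R a)) (p₁ a) (p₂ a))
    (harm : ∀ i ∈ l, zNorm (c i - w' i) < r' i ∧ ∃ q, (R' i : ℤ) ≤ zNorm (q - w' i) ∧
      PathIn (openGraph ω) univ (c i) q)
    (hdist : ∀ i ∈ l, ∀ j ∈ l, i ≠ j → ¬ PathIn (openGraph ω) univ (c i) (c j))
    (havoid : ∀ i ∈ l, ∀ a ∈ t, ¬ PathIn (openGraph ω) univ (c i) (p₁ a) ∧ ¬ PathIn (openGraph ω) univ (c i) (p₂ a)) :
    ω ∈ (⋂ a ∈ t, fourArmTwoClustersAt (w a) (r a) (R a)) □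
      disjointOccurrenceList (l.map fun i ↦ zOneArmAt (w' i) (r' i) (R' i)) := by
  classical
  -- finite witnesses of the crossings
  have hw₁ : ∀ a ∈ t, ∃ W : Finset (Sym2 (Site 2)), ↑W ⊆ ω ∧
      PathIn (openGraph ↑W) (zAnn (w a) (r a) (R a)) (p₁ a) (q₁ a) ∧
      ∀ e ∈ W, ∀ z ∈ e, PathIn (openGraph ω) (zAnn (w a) (r a) (R a)) (p₁ a) z :=
    fun a ha ↦ exists_finset_witness_of_pathIn (h4a a ha).2.2.2.2.1
  have hw₂ : ∀ a ∈ t, ∃ W : Finset (Sym2 (Site 2)), ↑W ⊆ ω ∧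
      PathIn (openGraph ↑W) (zAnn (w a) (r a) (R a)) (p₂ a) (q₂ a) ∧
      ∀ e ∈ W, ∀ z ∈ e, PathIn (openGraph ω) (zAnn (w a) (r a) (R a)) (p₂ a) z :=
    fun a ha ↦ exists_finset_witness_of_pathIn (h4a a ha).2.2.2.2.2.1
  choose! W₁ hW₁ω hW₁p hW₁c using hw₁
  choose! W₂ hW₂ω hW₂p hW₂c using hw₂
  -- finite witnesses of the arms, inside the clusters of the `c i`
  have key : ∀ i ∈ l, ∃ K : Finset (Sym2 (Site 2)), ↑K ⊆ ω ∧
      (↑K : Set (Sym2 (Site 2))) ∈ zOneArmAt (w' i) (r' i) (R' i) ∧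
      ∀ e ∈ K, ∀ z ∈ e, PathIn (openGraph ω) univ (c i) z := by
    intro i hi
    obtain ⟨hnear, q, hqR, hpath⟩ := harm i hi
    obtain ⟨p, q', hp, hq', hcross, hcp⟩ := exists_zAnn_crossing_of_pathIn hHG (hrR' i hi) hnear hqR hpath
    obtain ⟨K, hKω, hK, hKu⟩ := exists_finset_witness_of_pathIn hcross
    exact ⟨K, hKω, ⟨p, q', hp, hq', hK.mono inter_subset_right⟩, fun e he z hz ↦
      hcp.trans ((hKu e he z hz).mono inter_subset_left)⟩
  choose! K hKω hKA hKc using key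
  -- the cylinder of the four-arm events
  have hcyl : localCylinder (⋃ a ∈ t, (↑(W₁ a) ∪ ↑(W₂ a) ∪ ((zAnn (w a) (r a) (R a)).sym2 \ ω))) ω ⊆
      ⋂ a ∈ t, fourArmTwoClustersAt (w a) (r a) (R a) := by
    intro ω' hω'
    refine mem_iInter₂.2 fun a ha ↦ ?_
    obtain ⟨hp₁, hq₁, hp₂, hq₂, -, -, hn⟩ := h4a a ha
    exact localCylinder_subset_fourArm (hrR a ha).1 (hrR a ha).2 hp₁ hq₁ hp₂ hq₂ (hW₁ω a ha) (hW₂ω a ha)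
      (hW₁p a ha) (hW₂p a ha) hn
      (fun e he ↦ hω' e (mem_biUnion ha he))
  have hmem := mem_inter_disjointOccurrenceList_of_witnesses hcyl
    (l.map fun i ↦ (zOneArmAt (w' i) (r' i) (R' i), (↑(K i) : Set (Sym2 (Site 2)))))
    (fun q hq ↦ by
      obtain ⟨i, -, rfl⟩ := List.mem_map.1 hq
      exact isUpperSet_zOneArmAt _ _ _)
    (fun q hq ↦ by
      obtain ⟨i, hi, rfl⟩ := List.mem_map.1 hq
      exact hKA i hi)
    (fun q hq ↦ by
      obtain ⟨i, hi, rfl⟩ := List.mem_map.1 hq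
      exact hKω i hi)
    ?_ ?_
  · rw [List.map_map] at hmem
    exact hmem
  · -- arms in distinct clusters have edge-disjoint witnesses
    rw [List.pairwise_map]
    refine hl.pairwise_of_forall_ne fun i hi j hj hij ↦ ?_
    rw [Finset.disjoint_coe, Finset.disjoint_left]
    intro e hei hej
    obtain ⟨z, hz⟩ : ∃ z, z ∈ e := ⟨e.out.1, Sym2.out_fst_mem e⟩
    exact hdist i hi j hj hij ((hKc i hi e hei z hz).trans (hKc j hj e hej z hz).symm)
  · -- arm witnesses avoid the cylinder: they are open (not closed), and in other clusters than the crossings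
    intro q hq
    obtain ⟨i, hi, rfl⟩ := List.mem_map.1 hq
    rw [Set.disjoint_iUnion₂_left]
    intro a ha
    rw [Set.disjoint_left]
    rintro e (⟨he | he⟩ | he) heK
    · obtain ⟨z, hz⟩ : ∃ z, z ∈ e := ⟨e.out.1, Sym2.out_fst_mem e⟩
      exact (havoid i hi a ha).1 ((hKc i hi e heK z hz).trans (((hW₁c a ha e he z hz).mono (subset_univ _)).symm))
    · obtain ⟨z, hz⟩ : ∃ z, z ∈ e := ⟨e.out.1, Sym2.out_fst_mem e⟩
      exact (havoid i hi a ha).2 ((hKc i hi e heK z hz).trans (((hW₂c a ha e he z hz).mono (subset_univ _)).symm))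
    · exact he.2 (hKω i hi heK)

end NeckCoarseZ2

/-! ## §3 The glued bound -/

/-- **Four-arm node events over disjoint annuli AND arms of further pairwise distinct clusters (registered helper,
anchor of this module on the crux item).**  There are `c, ε, C, α > 0` (the constants of
`real_biInter_fourArmTwoClustersAt_le_prod_rpow` and `NeckCoarseZ2.real_zOneArmAt_le`) such that for all finite
families of pairwise disjoint annuli `zAnn (w a) (r a) (R a)` (`1 ≤ r a ≤ R a`) and of arm data
`(w' i, r' i, R' i)` (`1 ≤ r' i < R' i`, no disjointness required), the probability under `P_{1/2}` on `ℤ²` that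
every annulus carries two open crossings `p₁ a → q₁ a`, `p₂ a → q₂ a` not joined by an open path of the annulus,
and points `c i` with `|c i - w' i|_∞ < r' i` are joined by open paths to sup distance `≥ R' i` from `w' i`, the
`c i` in pairwise distinct open clusters containing none of the `p₁ a, p₂ a`, is at most
`(∏ c (r a / R a)^{1+ε}) · ∏ C (r' i / (R' i - 1))^α`. -/
theorem real_fourArm_and_distinctArms_le : ∃ c ε C α : ℝ, 0 < c ∧ 0 < ε ∧ 0 < C ∧ 0 < α ∧ ∀ (ι κ : Type) (t : Finset ι) (w : ι → Site 2) (r R : ι → ℕ) (u : Finset κ) (w' : κ → Site 2) (r' R' : κ → ℕ), (∀ a ∈ t, 1 ≤ r a ∧ r a ≤ R a) → (↑t : Set ι).PairwiseDisjoint (fun a ↦ NeckCoarseZ2.zAnn (w a) (r a) (R a)) → (∀ i ∈ u, 1 ≤ r' i ∧ r' i + 1 ≤ R' i) → (bondPercolation (zdGraph 2) half).real {ω | ∃ (p₁ q₁ p₂ q₂ : ι → Site 2) (c : κ → Site 2), (∀ a ∈ t, zNorm (p₁ a - w a) = r a ∧ zNorm (q₁ a - w a) = R a ∧ zNorm (p₂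 a - w a) = r a ∧ zNorm (q₂ a - w a) = R a ∧ PathIn (openGraph ω) (NeckCoarseZ2.zAnn (w a) (r a) (R a)) (p₁ a) (q₁ a) ∧ PathIn (openGraph ω) (NeckCoarseZ2.zAnn (w a) (r a) (R a)) (p₂ a) (q₂ a) ∧ ¬ PathIn (openGraph ω) (NeckCoarseZ2.zAnn (w a) (r a) (R a)) (p₁ a) (p₂ a)) ∧ (∀ i ∈ u, zNorm (c i - w' i) < r' i ∧ ∃ q, (R' i : ℤ) ≤ zNorm (q - w' i) ∧ PathIn (openGraph ω) Set.univ (c i) q) ∧ (∀ i ∈ u, ∀ j ∈ u, i ≠ j → ¬ PathIn (openGraph ω) Set.univ (c i) (c j)) ∧ (∀ i ∈ u, ∀ a ∈ t, ¬ PathIn (openGraph ω) Set.univ (c i) (p₁ a) ∧ ¬ PathIn (openGraph ω) Set.univ (c i) (p₂ a))} ≤ (∏ a ∈ t, c * ((r a : ℝ) / R a) ^ (1 + ε)) * ∏ i ∈ u, C * ((r' i : ℝ) / ((R' i - 1 : ℕ) : ℝ)) ^ α := by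
  obtain ⟨c, ε, hc, hε, h4⟩ := real_biInter_fourArmTwoClustersAt_le_prod_rpow
  obtain ⟨C, α, hC, hα, h1⟩ := NeckCoarseZ2.real_zOneArmAt_le
  refine ⟨c, ε, C, α, hc, hε, hC, hα, fun ι κ t w r R u w' r' R' hrR hdisj hrR' ↦ ?_⟩
  classical
  obtain ⟨E, hE⟩ : ∃ E : Set (BondConfig (Site 2)), E = {ω | ∃ (p₁ q₁ p₂ q₂ : ι → Site 2) (c : κ → Site 2),
      (∀ a ∈ t, zNorm (p₁ a - w a) = r a ∧ zNorm (q₁ a - w a) = R a ∧ zNorm (p₂ a - w a) = r a ∧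
        zNorm (q₂ a - w a) = R a ∧ PathIn (openGraph ω) (NeckCoarseZ2.zAnn (w a) (r a) (R a)) (p₁ a) (q₁ a) ∧
        PathIn (openGraph ω) (NeckCoarseZ2.zAnn (w a) (r a) (R a)) (p₂ a) (q₂ a) ∧
        ¬ PathIn (openGraph ω) (NeckCoarseZ2.zAnn (w a) (r a) (R a)) (p₁ a) (p₂ a)) ∧
      (∀ i ∈ u, zNorm (c i - w' i) < r' i ∧ ∃ q, (R' i : ℤ) ≤ zNorm (q - w' i) ∧
        PathIn (openGraph ω) Set.univ (c i) q) ∧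
      (∀ i ∈ u, ∀ j ∈ u, i ≠ j → ¬ PathIn (openGraph ω) Set.univ (c i) (c j)) ∧
      (∀ i ∈ u, ∀ a ∈ t, ¬ PathIn (openGraph ω) Set.univ (c i) (p₁ a) ∧
        ¬ PathIn (openGraph ω) Set.univ (c i) (p₂ a))} := ⟨_, rfl⟩
  rw [← hE]
  set μ := bondPercolation (zdGraph 2) half with hμ
  set L := u.toList.map fun i ↦ NeckCoarseZ2.zOneArmAt (w' i) (r' i) (R' i) with hL
  set A := ⋂ a ∈ t, fourArmTwoClustersAt (w a) (r a) (R a) with hA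
  -- off a null set, the event implies the disjoint occurrence of `A` and the arm events
  have hcover : E ∩ {ω | ω ⊆ (zdGraph 2).edgeSet} ⊆ A □ disjointOccurrenceList L := by
    rintro ω ⟨hω, hlat⟩
    rw [hE] at hω
    obtain ⟨p₁, q₁, p₂, q₂, cc, h4a, harm, hdist, havoid⟩ := hω
    have hHG : ∀ a b, (openGraph ω).Adj a b → (zdGraph 2).Adj a b := fun a b h ↦
      (SimpleGraph.mem_edgeSet _).1 (hlat ((openGraph_adj ω a b).1 h).1)
    exact NeckCoarseZ2.mem_fourArm_disjointOccurrence_arms hHG t w r R hrR u.toList (Finset.nodup_toList u)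
      w' r' R' (fun i hi ↦ by have := (hrR' i (Finset.mem_toList.1 hi)).2; omega) p₁ q₁ p₂ q₂ cc h4a
      (fun i hi ↦ harm i (Finset.mem_toList.1 hi))
      (fun i hi j hj hij ↦ hdist i (Finset.mem_toList.1 hi) j (Finset.mem_toList.1 hj) hij)
      fun i hi a ha ↦ havoid i (Finset.mem_toList.1 hi) a ha
  have hae : ∀ᵐ ω ∂μ, ω ⊆ (zdGraph 2).edgeSet := ae_subset_edgeSet (zdGraph 2) half
  have heq : μ.real E = μ.real (E ∩ {ω | ω ⊆ (zdGraph 2).edgeSet}) := by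
    refine measureReal_congr (Filter.eventuallyEq_set.2 (hae.mono fun ω hω ↦ ?_))
    simp only [mem_inter_iff, mem_setOf_eq, hω, and_true]
  have hup : ∀ D ∈ L, IsUpperSet D := fun D hD ↦ by
    obtain ⟨i, -, rfl⟩ := List.mem_map.1 hD
    exact NeckCoarseZ2.isUpperSet_zOneArmAt _ _ _
  have hfin : ∀ D ∈ L, IsFinitary D := fun D hD ↦ by
    obtain ⟨i, -, rfl⟩ := List.mem_map.1 hD
    exact NeckCoarseZ2.isFinitary_zOneArmAt _ _ _
  have hAloc : IsLocalEvent A := NeckCoarseZ2.isLocalEvent_biInter_fourArm t w r R fun a ha ↦ (hrR a ha).1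
  have hreimer : μ.real (A □ disjointOccurrenceList L) ≤ μ.real A * (L.map μ.real).prod := by
    have h := reimer_local_finitary_list (zdGraph 2) half hAloc isUpperSet_univ isFinitary_univ L hup hfin
    rwa [inter_univ] at h
  have hprod : (L.map μ.real).prod = ∏ i ∈ u, μ.real (NeckCoarseZ2.zOneArmAt (w' i) (r' i) (R' i)) := by
    rw [hL, List.map_map, Function.comp_def, Finset.prod_map_toList]
  have hA4 : μ.real A ≤ ∏ a ∈ t, c * ((r a : ℝ) / R a) ^ (1 + ε) := h4 ι t w r R hrR hdisj
  calc μ.real E = μ.real (E ∩ {ω | ω ⊆ (zdGraph 2).edgeSet}) := heq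
    _ ≤ μ.real (A □ disjointOccurrenceList L) := measureReal_mono hcover (measure_ne_top _ _)
    _ ≤ μ.real A * (L.map μ.real).prod := hreimer
    _ = μ.real A * ∏ i ∈ u, μ.real (NeckCoarseZ2.zOneArmAt (w' i) (r' i) (R' i)) := by rw [hprod]
    _ ≤ (∏ a ∈ t, c * ((r a : ℝ) / R a) ^ (1 + ε)) * ∏ i ∈ u, C * ((r' i : ℝ) / ((R' i - 1 : ℕ) : ℝ)) ^ α :=
        mul_le_mul hA4 (Finset.prod_le_prod (fun i _ ↦ measureReal_nonneg)
          fun i hi ↦ h1 (w' i) (r' i) (R' i) (hrR' i hi).1 (hrR' i hi).2)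
          (Finset.prod_nonneg fun i _ ↦ measureReal_nonneg) (le_trans measureReal_nonneg hA4)

end Summit.CriticalPhenomena.CardyFormulaZ2.Cruxes.NestingRigidity.PinchResampling

end
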